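import Mathlib.GroupTheory.SemidirectProduct
import Mathlib.GroupTheory.SpecificGroups.Dihedral
import Mathlib.Topology.Algebra.Category.ProfiniteGrp.Basic
import Mathlib.Topology.Instances.ZMod
import Mathlib.Tactic.LinearCombination
import Literature.IUT.HodgeTheaters.PuncturedEllipticCoveringsCusps
import HarnessLib

/-!
# A dihedral toy model of `PuncturedEllipticData` carrying a `CuspGalois` structure — non-vacuity witness

Mochizuki, *Inter-universal Teichmüller theory I*, kurims manuscript (May 2020), §1 p. 37
([IUTchI] §1 p.37) [claim: Mochizuki2012, status: disputed] (D-0012 claim key; series status DISPUTED —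
this file is a WITNESS-class module: a finite toy model, nothing of the series is asserted, no side is taken
on [IUTchIII] Cor. 3.12).  NV-L5 row `CuspGalois` (abc-iut-L5-lead RULINGS #27: a def-bearing witness is named
`<Interface>NonVacuityWitness.lean`, is not a cone member and owes no DEFS-freeze stamp).

WHAT IS WITNESSED.  The companion interface `PuncturedEllipticData.CuspGalois` (abc-iut-L5-t1,
`PuncturedEllipticCoveringsCusps.lean`: the action of `Gal(X̲/C) = Π_C/Π_X̲ ≅ 𝔽_l^{⋊±}` on the cusps of `X̲`, 11
laws) together with `ArrowOpenClaims` and every standing hypothesis of the frozen `PuncturedEllipticData` is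
JOINTLY SATISFIABLE AS TYPED, for EVERY integer `l ≥ 5` prime to `6`: `nonempty_cuspGalois_toy`.  The model
(label: TOY — a finite shadow of the printed situation, NOT the arithmetic object) is the finite group
  `Π_C := N ⋊ D_l`,  `N := (ℤ/l)²` (pairs `(a, c)`), `D_l = ⟨r, s⟩` the dihedral group of order `2l`
acting on `N` by `r_k · (a, c) = (a, c − k a)`, `s r_k · (a, c) = (a, −c + k a)` (the reduction of the
Heisenberg group `U₃(𝔽_l) ⋊ ⟨diag(1,1,−1)⟩` modulo nothing: `N` = the matrices `(1 a c; 0 1 0; 0 0 1)`,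
`r = (1 0 0; 0 1 1; 0 0 1)`, `s = diag(1, 1, −1)`), with the discrete topology and trivial Galois group
`G_k = 1`; `Π_X := N ⋊ ⟨r⟩` (index `2`), `Π_C̲ := N ⋊ ⟨s⟩`, so `Π_X̲ = N`; the cusps of `X̲` are the
`l` SLOPES `i ∈ ℤ/l`, with decomposition group `D_i := {(a, i a)} ⊆ N` (the lines through the origin other
than the `c`-axis); `ε⁰, ε′, ε″, 2ε := 0, 1, −1, 2`.  Then `Gal(X̲/C) = D_l` permutes the slopes by
`r_k : i ↦ i − k`, `s r_k : i ↦ k − i` — the rotations `Gal(X̲/X) ≅ ℤ/l` act simply transitively, the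
reflection `s = ι̲` fixes `0` and switches `±1`, `s r_k s = r_{−k}` ([EtTh] Rmk. 2.1.1 "`ι̲` acts on `Q` by
`−1`"), and `2ε = r_{−1}² · ε⁰`.  Every field is PROVED (no `sorry`, axioms standard); `decide` is not used
(symbolic `l`).  Not modelled here: `ArrowCoveringClaims` (in this toy `Δ_ε⁺` collapses; the frozen
`TrivialModel.toyDatum` of `PuncturedEllipticCoveringsModel.lean` witnesses those claims separately).
-/

namespace Literature.IUT.HodgeTheaters

namespace PuncturedEllipticData

namespace DihedralToy

open Literature.AnabelianGeometry.AbsoluteAnabelian DihedralGroup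
open scoped Pointwise

variable (l : ℕ)

/-! ### The group `N ⋊ D_l` -/

/-- `N := (ℤ/l)²`, written multiplicatively (pairs `(a, c)` = the matrices `(1 a c; 0 1 0; 0 0 1)`).
[claim: Mochizuki2012, status: disputed] -/
abbrev N : Type := Multiplicative (ZMod l × ZMod l)

/-- The additive automorphism `(a, c) ↦ (a, ε c + k a)` of `(ℤ/l)²` for a sign `ε` (`ε² = 1`).
[claim: Mochizuki2012, status: disputed] -/
def linAut (ε k : ZMod l) (hε : ε * ε = 1) : (ZMod l × ZMod l) ≃+ (ZMod l × ZMod l) where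
  toFun p := (p.1, ε * p.2 + k * p.1)
  invFun p := (p.1, ε * p.2 - ε * k * p.1)
  left_inv p := by
    obtain ⟨a, c⟩ := p
    simp only [Prod.mk.injEq, true_and]
    linear_combination c * hε
  right_inv p := by
    obtain ⟨a, c⟩ := p
    simp only [Prod.mk.injEq, true_and]
    linear_combination (c - k * a) * hε
  map_add' p q := by
    obtain ⟨a, c⟩ := p
    obtain ⟨a', c'⟩ := q
    simp only [Prod.mk_add_mk, Prod.mk.injEq, true_and]
    ring

/-- The action of `D_l` on `(ℤ/l)²`: `r_k ↦ ((a,c) ↦ (a, c − k a))`, `s r_k ↦ ((a,c) ↦ (a, −c + k a))`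
(conjugation by `r = (1 0 0; 0 1 1; 0 0 1)` and `s = diag(1,1,−1)` on the Heisenberg matrices).
[claim: Mochizuki2012, status: disputed] -/
def dact : DihedralGroup l → (ZMod l × ZMod l) ≃+ (ZMod l × ZMod l)
  | r k => linAut l 1 (-k) (one_mul 1)
  | sr k => linAut l (-1) k (by ring)

/-- Second coordinate of the action of a rotation. [claim: Mochizuki2012, status: disputed] -/
theorem dact_r_apply (k : ZMod l) (p : ZMod l × ZMod l) : dact l (r k) p = (p.1, p.2 - k * p.1) := by
  show (p.1, 1 * p.2 + -k * p.1) = _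
  ext <;> simp; ring

/-- Second coordinate of the action of a reflection. [claim: Mochizuki2012, status: disputed] -/
theorem dact_sr_apply (k : ZMod l) (p : ZMod l × ZMod l) : dact l (sr k) p = (p.1, -p.2 + k * p.1) := by
  show (p.1, -1 * p.2 + k * p.1) = _
  ext <;> simp

/-- The action is multiplicative: `dact (d e) = dact d ∘ dact e`. [claim: Mochizuki2012, status: disputed] -/
theorem dact_mul (d e : DihedralGroup l) (p : ZMod l × ZMod l) :
    dact l (d * e) p = dact l d (dact l e p) := by
  cases d <;> cases e <;>
    simp only [r_mul_r, r_mul_sr, sr_mul_r, sr_mul_sr, dact_r_apply, dact_sr_apply, Prod.mk.injEq,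
      true_and] <;> ring

/-- The action homomorphism `D_l → Aut(N)`. [claim: Mochizuki2012, status: disputed] -/
def phi : DihedralGroup l →* MulAut (N l) where
  toFun d := AddEquiv.toMultiplicative (dact l d)
  map_one' := by
    refine MulEquiv.ext fun p => ?_
    change Multiplicative.ofAdd (dact l (r 0) (Multiplicative.toAdd p)) = p
    rw [dact_r_apply]
    simp
  map_mul' d e := by
    refine MulEquiv.ext fun p => ?_
    change Multiplicative.ofAdd (dact l (d * e) (Multiplicative.toAdd p)) =
      Multiplicative.ofAdd (dact l d (Multiplicative.toAdd
        (Multiplicative.ofAdd (dact l e (Multiplicative.toAdd p)))))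
    rw [toAdd_ofAdd, dact_mul]

/-- `toAdd (φ d n) = dact d (toAdd n)`. [claim: Mochizuki2012, status: disputed] -/
theorem toAdd_phi_apply (d : DihedralGroup l) (n : N l) :
    Multiplicative.toAdd (phi l d n) = dact l d (Multiplicative.toAdd n) := rfl

/-- The ambient group of the toy model: `Π_C := N ⋊ D_l` (order `2 l³`). [claim: Mochizuki2012, status: disputed] -/
abbrev G : Type := N l ⋊[phi l] DihedralGroup l

/-- `Π_C` is finite. [claim: Mochizuki2012, status: disputed] -/
theorem finite_G [NeZero l] : Finite (G l) :=
  Finite.of_equiv _ SemidirectProduct.equivProd.symm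

/-! ### The subgroups `Π_X`, `Π_C̲`, and the decomposition groups `D_i` -/

/-- `Π_X := N ⋊ ⟨r⟩` (the elements whose `D_l`-component is a rotation). [claim: Mochizuki2012, status: disputed] -/
def PiXm : Subgroup (G l) where
  carrier := {g | ∃ k : ZMod l, g.right = r k}
  mul_mem' := by
    rintro g h ⟨k, hk⟩ ⟨k', hk'⟩
    exact ⟨k + k', by rw [SemidirectProduct.mul_right, hk, hk', r_mul_r]⟩
  one_mem' := ⟨0, by rw [SemidirectProduct.one_right, r_zero]⟩
  inv_mem' := by
    rintro g ⟨k, hk⟩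
    exact ⟨-k, by rw [SemidirectProduct.inv_right, hk, inv_r]⟩

/-- `Π_C̲ := N ⋊ ⟨s⟩` (the elements whose `D_l`-component is `1` or `s = sr 0`). [claim: Mochizuki2012, status: disputed] -/
def PiCbarm : Subgroup (G l) where
  carrier := {g | g.right = 1 ∨ g.right = sr 0}
  mul_mem' := by
    rintro g h (hg | hg) (hh | hh) <;>
      simp only [Set.mem_setOf_eq, SemidirectProduct.mul_right, hg, hh, one_mul, mul_one, sr_mul_sr,
        sub_self, r_zero, true_or, or_true]
  one_mem' := Or.inl SemidirectProduct.one_right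
  inv_mem' := by
    rintro g (hg | hg)
    · exact Or.inl (by rw [SemidirectProduct.inv_right, hg, inv_one])
    · exact Or.inr (by rw [SemidirectProduct.inv_right, hg, inv_sr])

/-- Membership in `Π_X`. [claim: Mochizuki2012, status: disputed] -/
theorem mem_PiXm_iff (g : G l) : g ∈ PiXm l ↔ ∃ k : ZMod l, g.right = r k := Iff.rfl

/-- Membership in `Π_C̲`. [claim: Mochizuki2012, status: disputed] -/
theorem mem_PiCbarm_iff (g : G l) : g ∈ PiCbarm l ↔ g.right = 1 ∨ g.right = sr 0 := Iff.rfl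

/-- `Π_X ∩ Π_C̲ = N` (the elements with trivial `D_l`-component). [claim: Mochizuki2012, status: disputed] -/
theorem mem_PiXm_inf_PiCbarm_iff (g : G l) : g ∈ PiXm l ⊓ PiCbarm l ↔ g.right = 1 := by
  rw [Subgroup.mem_inf, mem_PiXm_iff, mem_PiCbarm_iff]
  constructor
  · rintro ⟨⟨k, hk⟩, h1 | h1⟩
    · exact h1
    · rw [hk] at h1; cases h1
  · intro h
    exact ⟨⟨0, by rw [h, r_zero]⟩, Or.inl h⟩

/-- The decomposition group of the cusp (slope) `i`: `D_i := {(a, i a)} ⊆ N`. [claim: Mochizuki2012, status: disputed] -/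
def decompm (i : ZMod l) : Subgroup (G l) where
  carrier := {g | g.right = 1 ∧ (Multiplicative.toAdd g.left).2 = i * (Multiplicative.toAdd g.left).1}
  mul_mem' := by
    rintro g h ⟨hg1, hg2⟩ ⟨hh1, hh2⟩
    refine ⟨by rw [SemidirectProduct.mul_right, hg1, hh1, mul_one], ?_⟩
    rw [SemidirectProduct.mul_left, hg1, map_one, MulAut.one_apply, toAdd_mul, Prod.snd_add,
      Prod.fst_add, hg2, hh2, mul_add]
  one_mem' := ⟨SemidirectProduct.one_right, by simp [SemidirectProduct.one_left]⟩
  inv_mem' := by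
    rintro g ⟨hg1, hg2⟩
    refine ⟨by rw [SemidirectProduct.inv_right, hg1, inv_one], ?_⟩
    rw [SemidirectProduct.inv_left, hg1, inv_one, map_one, MulAut.one_apply, toAdd_inv, Prod.snd_neg,
      Prod.fst_neg, hg2, mul_neg]

/-- Membership in `D_i`. [claim: Mochizuki2012, status: disputed] -/
theorem mem_decompm_iff (i : ZMod l) (g : G l) : g ∈ decompm l i ↔
    g.right = 1 ∧ (Multiplicative.toAdd g.left).2 = i * (Multiplicative.toAdd g.left).1 := Iff.rfl

/-- `[Π_C : Π_X] = 2` (`s ∉ Π_X` and `g s ∈ Π_X ↔ g ∉ Π_X`). [claim: Mochizuki2012, status: disputed] -/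
theorem index_PiXm : (PiXm l).index = 2 := by
  rw [Subgroup.index_eq_two_iff]
  refine ⟨⟨1, sr 0⟩, fun g => ?_⟩
  have hmul : (g * (⟨1, sr 0⟩ : G l)).right = g.right * sr 0 := rfl
  rw [mem_PiXm_iff, mem_PiXm_iff, hmul]
  rcases g.right with k | k
  · right
    refine ⟨⟨k, rfl⟩, ?_⟩
    rintro ⟨k', hk'⟩
    rw [r_mul_sr] at hk'
    cases hk'
  · left
    refine ⟨⟨0 - k, by rw [sr_mul_sr]⟩, ?_⟩
    rintro ⟨k', hk'⟩
    cases hk'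

/-! ### The cusp permutation action `Π_C → D_l → Perm(ℤ/l)` -/

/-- The action of `D_l` on the slopes: `r_k : i ↦ i − k`, `s r_k : i ↦ k − i`. [claim: Mochizuki2012, status: disputed] -/
def slopeAct : DihedralGroup l → Equiv.Perm (ZMod l)
  | r k => Equiv.subRight k
  | sr k => Equiv.subLeft k

/-- `slopeAct` on a rotation. [claim: Mochizuki2012, status: disputed] -/
theorem slopeAct_r (k i : ZMod l) : slopeAct l (r k) i = i - k := rfl

/-- `slopeAct` on a reflection. [claim: Mochizuki2012, status: disputed] -/
theorem slopeAct_sr (k i : ZMod l) : slopeAct l (sr k) i = k - i := rfl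

/-- `slopeAct` is a homomorphism `D_l → Perm(ℤ/l)`. [claim: Mochizuki2012, status: disputed] -/
def slopeHom : DihedralGroup l →* Equiv.Perm (ZMod l) where
  toFun := slopeAct l
  map_one' := by
    refine Equiv.ext fun i => ?_
    rw [one_def, slopeAct_r, sub_zero, Equiv.Perm.one_apply]
  map_mul' d e := by
    refine Equiv.ext fun i => ?_
    rw [Equiv.Perm.mul_apply]
    cases d <;> cases e <;>
      simp only [r_mul_r, r_mul_sr, sr_mul_r, sr_mul_sr, slopeAct_r, slopeAct_sr] <;> ring

/-- The cusp action of `Π_C = N ⋊ D_l`: through the quotient `D_l`. [claim: Mochizuki2012, status: disputed] -/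
def actm : G l →* Equiv.Perm (ZMod l) := (slopeHom l).comp SemidirectProduct.rightHom

/-- `actm g = slopeAct g.right`. [claim: Mochizuki2012, status: disputed] -/
theorem actm_apply (g : G l) (i : ZMod l) : actm l g i = slopeAct l g.right i := rfl

/-- KEY COMPUTATION: conjugation by `g = (n, d)` carries `D_i` EXACTLY onto `D_{d·i}` (`N` is abelian and
`d·(a, i a) = (a, (d·i) a)`). [claim: Mochizuki2012, status: disputed] -/
theorem conj_smul_decompm (g : G l) (i : ZMod l) :
    MulAut.conj g • decompm l i = decompm l (actm l g i) := by
  ext x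
  rw [Subgroup.mem_pointwise_smul_iff_inv_smul_mem, MulAut.smul_def, MulAut.conj_inv_apply,
    mem_decompm_iff, mem_decompm_iff, actm_apply]
  -- the `D_l`-components: `g⁻¹ x g` has trivial component iff `x` has
  have hright : (g⁻¹ * x * g).right = 1 ↔ x.right = 1 := by
    rw [SemidirectProduct.mul_right, SemidirectProduct.mul_right, SemidirectProduct.inv_right]
    constructor
    · intro h
      have h' := congrArg (fun y => g.right * y * g.right⁻¹) h
      simp only [mul_one, mul_inv_cancel] at h'
      rw [← h']; group
    · intro h
      rw [h, mul_one, inv_mul_cancel]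
  constructor
  · rintro ⟨h1, h2⟩
    have hx : x.right = 1 := hright.mp h1
    refine ⟨hx, ?_⟩
    -- `(g⁻¹ x g).left = φ(d⁻¹)(n⁻¹ · x.left · n) = φ(d⁻¹)(x.left)`
    have hleft : (g⁻¹ * x * g).left = phi l g.right⁻¹ x.left := by
      rw [SemidirectProduct.mul_left, SemidirectProduct.mul_left, SemidirectProduct.inv_left,
        SemidirectProduct.mul_right, SemidirectProduct.inv_right, hx, mul_one, ← map_mul,
        ← map_mul, mul_comm (g.left⁻¹ * x.left) g.left, ← mul_assoc, mul_inv_cancel, one_mul]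
    rw [hleft, toAdd_phi_apply] at h2
    set p := Multiplicative.toAdd x.left with hp
    rcases hd : g.right with k | k
    · rw [hd, inv_r, dact_r_apply] at h2
      rw [slopeAct_r]
      -- h2 : p.2 - (-k) * p.1 = i * p.1
      linear_combination h2
    · rw [hd, inv_sr, dact_sr_apply] at h2
      rw [slopeAct_sr]
      -- h2 : -p.2 + k * p.1 = i * p.1
      linear_combination -h2
  · rintro ⟨hx, h2⟩
    refine ⟨hright.mpr hx, ?_⟩
    have hleft : (g⁻¹ * x * g).left = phi l g.right⁻¹ x.left := by
      rw [SemidirectProduct.mul_left, SemidirectProduct.mul_left, SemidirectProduct.inv_left,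
        SemidirectProduct.mul_right, SemidirectProduct.inv_right, hx, mul_one, ← map_mul,
        ← map_mul, mul_comm (g.left⁻¹ * x.left) g.left, ← mul_assoc, mul_inv_cancel, one_mul]
    rw [hleft, toAdd_phi_apply]
    set p := Multiplicative.toAdd x.left with hp
    rcases hd : g.right with k | k
    · rw [inv_r, dact_r_apply]
      rw [hd, slopeAct_r] at h2
      linear_combination h2
    · rw [inv_sr, dact_sr_apply]
      rw [hd, slopeAct_sr] at h2
      linear_combination -h2

/-- The element `(0, 1·… )`: `(ofAdd (1, i), 1) ∈ D_i` — a point of slope `i` with nonzero abscissa, used to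
tell the lines apart. [claim: Mochizuki2012, status: disputed] -/
theorem mk_mem_decompm (i : ZMod l) :
    (⟨Multiplicative.ofAdd ((1 : ZMod l), i), 1⟩ : G l) ∈ decompm l i :=
  ⟨rfl, by simp⟩

/-- Distinct slopes give distinct lines: `D_i = D_j → i = j`. [claim: Mochizuki2012, status: disputed] -/
theorem decompm_injective : Function.Injective (decompm l) := by
  intro i j h
  have hm := mk_mem_decompm l i
  rw [h, mem_decompm_iff] at hm
  simpa using hm.2

/-! ### The laws of `CuspGalois`, at the level of `N ⋊ D_l` -/

/-- An element of `Π_C̲` outside `Π_X` has `D_l`-component `s`. [claim: Mochizuki2012, status: disputed] -/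
theorem right_eq_sr_of_mem_PiCbarm {c : G l} (hc : c ∈ PiCbarm l) (hcX : c ∉ PiXm l) : c.right = sr 0 := by
  rcases hc with h1 | h1
  · exact absurd ⟨0, by rw [h1, r_zero]⟩ hcX
  · exact h1

/-- `act_decomp` in the toy (with `t = 1`). [claim: Mochizuki2012, status: disputed] -/
theorem act_decomp_aux (g : G l) (i : ZMod l) :
    ∃ t ∈ PiXm l ⊓ PiCbarm l, MulAut.conj (t * g) • decompm l i = decompm l (actm l g i) :=
  ⟨1, Subgroup.one_mem _, by rw [one_mul]; exact conj_smul_decompm l g i⟩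

/-- `eq_of_conj` in the toy: `N` acts trivially on its own subgroups and the lines are distinct.
[claim: Mochizuki2012, status: disputed] -/
theorem eq_of_conj_aux (i j : ZMod l) (t : G l) (ht : t ∈ PiXm l ⊓ PiCbarm l)
    (h : MulAut.conj t • decompm l i = decompm l j) : i = j := by
  have ht1 : t.right = 1 := (mem_PiXm_inf_PiCbarm_iff l t).mp ht
  have h' := conj_smul_decompm l t i
  have hti : actm l t i = i := by
    rw [actm_apply, ht1]
    exact sub_zero i
  rw [hti] at h'
  exact decompm_injective l (h'.symm.trans h)

/-- `free` in the toy: a rotation fixing a slope is trivial. [claim: Mochizuki2012, status: disputed] -/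
theorem free_aux (g : G l) (hg : g ∈ PiXm l) (i : ZMod l) (h : actm l g i = i) : g ∈ PiXm l ⊓ PiCbarm l := by
  obtain ⟨k, hk⟩ := hg
  rw [actm_apply, hk, slopeAct_r, sub_eq_self] at h
  exact (mem_PiXm_inf_PiCbarm_iff l g).mpr (by rw [hk, h, r_zero])

/-- `transitive` in the toy: `r_{i−j}` carries `i` to `j`. [claim: Mochizuki2012, status: disputed] -/
theorem transitive_aux (i j : ZMod l) : ∃ g ∈ PiXm l, actm l g i = j :=
  ⟨⟨1, r (i - j)⟩, ⟨i - j, rfl⟩, by rw [actm_apply]; exact sub_sub_cancel i j⟩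

/-- `exists_generator` in the toy: `(1, r 1)` generates the image of `Π_X`. [claim: Mochizuki2012, status: disputed] -/
theorem generator_aux [NeZero l] : ∃ g ∈ PiXm l, ∀ h ∈ PiXm l, ∃ n : ℤ, actm l h = actm l g ^ n := by
  refine ⟨⟨1, r 1⟩, ⟨1, rfl⟩, ?_⟩
  rintro h ⟨k, hk⟩
  refine ⟨(k.val : ℤ), ?_⟩
  rw [zpow_natCast, ← map_pow]
  refine Equiv.ext fun i => ?_
  have hr : (((⟨1, r 1⟩ : G l) ^ k.val).right : DihedralGroup l) = r k := by
    have h1 : ((⟨1, r 1⟩ : G l) ^ k.val).right = (r 1 : DihedralGroup l) ^ k.val :=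
      map_pow (SemidirectProduct.rightHom (N := N l) (G := DihedralGroup l) (φ := phi l)) _ _
    rw [h1, r_one_pow, ZMod.natCast_zmod_val]
  rw [actm_apply, actm_apply, hk, hr]

/-- `conj_mul_mem_PiXbar` in the toy: `s r_k s r_k = 1` in `D_l`. [claim: Mochizuki2012, status: disputed] -/
theorem conj_aux (c : G l) (hc : c ∈ PiCbarm l) (hcX : c ∉ PiXm l) (g : G l) (hg : g ∈ PiXm l) :
    c * g * c⁻¹ * g ∈ PiXm l ⊓ PiCbarm l := by
  obtain ⟨k, hk⟩ := hg
  have hc' := right_eq_sr_of_mem_PiCbarm l hc hcX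
  refine (mem_PiXm_inf_PiCbarm_iff l _).mpr ?_
  rw [SemidirectProduct.mul_right, SemidirectProduct.mul_right, SemidirectProduct.mul_right,
    SemidirectProduct.inv_right, hc', hk, inv_sr, sr_mul_r, sr_mul_sr, r_mul_r, zero_add,
    zero_sub, neg_add_cancel, r_zero]

/-- `act_ε0` in the toy: `Π_C̲` fixes the slope `0`. [claim: Mochizuki2012, status: disputed] -/
theorem act0_aux (c : G l) (hc : c ∈ PiCbarm l) : actm l c 0 = 0 := by
  rcases hc with hc | hc
  · rw [actm_apply, hc]
    exact sub_zero (0 : ZMod l)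
  · rw [actm_apply, hc, slopeAct_sr, sub_zero]

/-- `act_ε1` in the toy: `s` switches the slopes `±1`. [claim: Mochizuki2012, status: disputed] -/
theorem act1_aux (c : G l) (hc : c ∈ PiCbarm l) (hcX : c ∉ PiXm l) : actm l c 1 = -1 := by
  rw [actm_apply, right_eq_sr_of_mem_PiCbarm l hc hcX, slopeAct_sr, zero_sub]

/-- `act_twoε` in the toy: `2 = r_{−1}² · 0`. [claim: Mochizuki2012, status: disputed] -/
theorem act2_aux (g : G l) (hg : g ∈ PiXm l) (h : actm l g 0 = 1) :
    actm l (g * g) 0 = 2 ∨ actm l (g⁻¹ * g⁻¹) 0 = 2 := by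
  obtain ⟨k, hk⟩ := hg
  left
  rw [actm_apply, hk, slopeAct_r, zero_sub] at h
  rw [actm_apply, SemidirectProduct.mul_right, hk, r_mul_r, slopeAct_r, zero_sub]
  linear_combination 2 * h

/-! ### The profinite packaging and the datum -/

/-- `Π_C = N ⋊ D_l` as a (finite, discrete) profinite group. [claim: Mochizuki2012, status: disputed] -/
noncomputable abbrev arithGrp [NeZero l] : ProfiniteGrp.{0} :=
  ProfiniteGrp.ofFiniteGrp (@FiniteGrp.of (G l) _ (finite_G l))

/-- The topology of `Π_C` is discrete. [claim: Mochizuki2012, status: disputed] -/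
theorem discreteTopology_arithGrp [NeZero l] : DiscreteTopology (arithGrp l) := ⟨rfl⟩

/-- The trivial Galois group `G_k = 1`. [claim: Mochizuki2012, status: disputed] -/
abbrev Gal : Type := Multiplicative (ZMod 1)

/-- The augmentation `Π_C ↠ G_k = 1`. [claim: Mochizuki2012, status: disputed] -/
noncomputable def augm [NeZero l] : arithGrp l →ₜ* ProfiniteGrp.of Gal where
  toFun _ := 1
  map_one' := rfl
  map_mul' _ _ := (mul_one _).symm
  continuous_toFun := continuous_const

/-- The extension `Π_C ↠ G_k` of the toy model. [claim: Mochizuki2012, status: disputed] -/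
noncomputable abbrev toyExt [NeZero l] : FundamentalExtension.{0} where
  arith := arithGrp l
  gal := ProfiniteGrp.of Gal
  aug := augm l
  aug_surjective _ := ⟨1, Subsingleton.elim _ _⟩

/-- `Δ_C = Π_C` (the Galois group is trivial). [claim: Mochizuki2012, status: disputed] -/
theorem geom_eq_top [NeZero l] : (toyExt l).geom = ⊤ := by
  ext x
  simp only [Subgroup.mem_top, iff_true]
  exact Subsingleton.elim _ _

/-- `2 ≠ 0, ±1` and `1 ≠ 0, −1`, `−1 ≠ 0` in `ℤ/l` for `l ≥ 5`. [claim: Mochizuki2012, status: disputed] -/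
theorem units_facts (h5 : 5 ≤ l) :
    (1 : ZMod l) ≠ 0 ∧ (-1 : ZMod l) ≠ 0 ∧ (1 : ZMod l) ≠ -1 ∧
      (2 : ZMod l) ≠ 0 ∧ (2 : ZMod l) ≠ 1 ∧ (2 : ZMod l) ≠ -1 := by
  have hk : ∀ k : ℕ, 0 < k → k < 5 → ((k : ZMod l) ≠ 0) := by
    intro k hk0 hk5 h
    rw [ZMod.natCast_eq_zero_iff] at h
    exact absurd (Nat.le_of_dvd hk0 h) (by omega)
  have h1 : (1 : ZMod l) ≠ 0 := by exact_mod_cast hk 1 one_pos (by norm_num)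
  have h2 : (2 : ZMod l) ≠ 0 := by exact_mod_cast hk 2 two_pos (by norm_num)
  have h3 : (3 : ZMod l) ≠ 0 := by exact_mod_cast hk 3 three_pos (by norm_num)
  refine ⟨h1, neg_ne_zero.mpr h1, fun h => h2 ?_, h2, fun h => h1 ?_, fun h => h3 ?_⟩
  · linear_combination h
  · linear_combination h
  · linear_combination h

/-- **The toy datum** for `l ≥ 5` prime to `6`: `Π_C = N ⋊ D_l ↠ 1`, `Π_X = N ⋊ ⟨r⟩`, `Π_C̲ = N ⋊ ⟨s⟩`,
cusps `= ℤ/l` (slopes) with `D_i` the line of slope `i`, `ε⁰, ε′, ε″, 2ε = 0, 1, −1, 2`.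
([IUTchI] §1 p.37) [claim: Mochizuki2012, status: disputed] -/
noncomputable abbrev toyDatum (h5 : 5 ≤ l) (h6 : Nat.Coprime l 6) : PuncturedEllipticData.{0} :=
  haveI : NeZero l := ⟨by omega⟩
  { l := l
    five_le := h5
    coprime_six := h6
    E := toyExt l
    PiX := PiXm l
    PiCbar := PiCbarm l
    isOpen_piX := @isOpen_discrete _ _ (discreteTopology_arithGrp l) _
    isOpen_piCbar := @isOpen_discrete _ _ (discreteTopology_arithGrp l) _
    index_piX := index_PiXm l
    aug_piX := fun _ => ⟨1, Subsingleton.elim _ _⟩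
    aug_piCbar := fun _ => ⟨1, Subsingleton.elim _ _⟩
    star := by
      intro g hg x hx
      have hg' : g ∈ PiXm l ⊓ (toyExt l).geom := ⟨hg, by rw [geom_eq_top]; trivial⟩
      refine Subgroup.le_topologicalClosure _ (Subgroup.mem_sup_left ?_)
      rw [← commutatorElement_def]
      exact Subgroup.commutator_mem_commutator hg' hx
    Cusp := ZMod l
    decomp := decompm l
    decomp_le := by
      intro i g hg
      exact (mem_PiXm_inf_PiCbarm_iff l g).mpr hg.1
    ε0 := 0
    ε1 := 1
    ε2 := -1
    twoε := 2
    ε1_ne_ε0 := (units_facts l h5).1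
    ε2_ne_ε0 := (units_facts l h5).2.1
    ε1_ne_ε2 := (units_facts l h5).2.2.1
    twoε_ne := (units_facts l h5).2.2.2
    aug_decomp_twoε := fun _ => ⟨1, Subsingleton.elim _ _⟩ }

/-! ### The `CuspGalois` structure of the toy datum -/

/-- **The cusp Galois action of the toy datum**: `act := slopeAct ∘ (projection to D_l)`; all eleven laws
hold (rotations act simply transitively on the slopes, `s` fixes `0`, switches `±1`, inverts rotations;
`2ε = 2 = r_{−1}²·0`). ([IUTchI] §1 p.37) [claim: Mochizuki2012, status: disputed] -/
noncomputable def toyCuspGalois (h5 : 5 ≤ l) (h6 : Nat.Coprime l 6) : (toyDatum l h5 h6).CuspGalois :=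
  haveI : NeZero l := ⟨by omega⟩
  { act := actm l
    act_decomp := act_decomp_aux l
    eq_of_conj := eq_of_conj_aux l
    isClosed_decomp := fun _ => @isClosed_discrete _ _ (discreteTopology_arithGrp l) _
    free := free_aux l
    transitive := transitive_aux l
    exists_generator := generator_aux l
    conj_mul_mem_PiXbar := conj_aux l
    act_ε0 := act0_aux l
    act_ε1 := act1_aux l
    act_twoε := act2_aux l }

/-- The toy datum also satisfies the openness clause `ArrowOpenClaims` (discrete topology).
([IUTchI] §1 p.38) [claim: Mochizuki2012, status: disputed] -/
theorem toy_arrowOpenClaims (h5 : 5 ≤ l) (h6 : Nat.Coprime l 6) : (toyDatum l h5 h6).ArrowOpenClaims := by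
  haveI : NeZero l := ⟨by omega⟩
  exact ⟨@isOpen_discrete _ _ (discreteTopology_arithGrp l) _,
    @isOpen_discrete _ _ (discreteTopology_arithGrp l) _⟩

/-- **NON-VACUITY of `CuspGalois` (TOY witness)**: for every `l ≥ 5` prime to `6` there is a
`PuncturedEllipticData` with that `l` carrying a `CuspGalois` structure and satisfying `ArrowOpenClaims`
— the eleven laws of the companion interface are jointly satisfiable as typed.  TOY label: a finite
dihedral shadow (`N ⋊ D_l`, `G_k = 1`), not the arithmetic fundamental group of a punctured elliptic curve.
([IUTchI] §1 p.37) [claim: Mochizuki2012, status: disputed] -/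
theorem nonempty_cuspGalois_toy (h5 : 5 ≤ l) (h6 : Nat.Coprime l 6) :
    ∃ D : PuncturedEllipticData.{0}, D.l = l ∧ Nonempty D.CuspGalois ∧ D.ArrowOpenClaims :=
  ⟨toyDatum l h5 h6, rfl, ⟨toyCuspGalois l h5 h6⟩, toy_arrowOpenClaims l h5 h6⟩

/-- Instance at `l = 5`. ([IUTchI] §1 p.37) [claim: Mochizuki2012, status: disputed] -/
theorem nonempty_cuspGalois_toy_five :
    ∃ D : PuncturedEllipticData.{0}, D.l = 5 ∧ Nonempty D.CuspGalois ∧ D.ArrowOpenClaims :=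
  nonempty_cuspGalois_toy 5 le_rfl (by decide)

end DihedralToy

end PuncturedEllipticData

end Literature.IUT.HodgeTheaters
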